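import Summits.KontsevichZagierPeriods.KontsevichZagierPeriods.Theses.ToricCore
import Literature.NumberTheory.Transcendental.KZToricCalculus

/-!
# `ToricSound` (stmt-KontsevichZagierPeriods-7842, route ToricCore) — proof

The toric sub-calculus `R_tor` of route ToricCore (the second `let` of every item; token for token
the Literature constant `KZ.toricRelations`) is contained in `KZ.relations`.

`R_tor` is generated by (a) the instances of the KZ moves (1a) domain additivity, (1b) integrand
additivity, (3) Newton–Leibniz lying in the toric span — these are relations by definition, the
intersection with the span only shrinks the generating set — and (b) the integer MONOMIAL changes
of variables `Φ_A x = (∏ⱼ xⱼ ^ A i j)ᵢ`, `A ∈ Mₙ(ℤ)`, `det A ≠ 0`, on domains inside the open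
positive orthant, with the Jacobian factor `|det A| · (∏ᵢ ∏ⱼ xⱼ ^ A i j) / ∏ⱼ xⱼ`. For (b) we
check the three analytic clauses of `KZ.changeOfVariablesRel` (rule (2)):

* `Φ_A` is `ℚ`-semialgebraic on the domain: each coordinate is a Laurent monomial, i.e. the
  quotient `x^{a⁺} / x^{a⁻}` of two monomials with non-vanishing denominator;
* `Φ_A` is differentiable at every point with non-zero coordinates, with derivative the linear
  map of matrix `(Φᵢ(x) · A i j / xⱼ)ᵢⱼ = diag(Φ(x)) · A · diag(x)⁻¹` (Leibniz rule for
  `∏ⱼ xⱼ ^ A i j`), whose determinant is `(∏ᵢ Φᵢ(x)) · det A · ∏ⱼ xⱼ⁻¹`;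
* `Φ_A` is injective on the open positive orthant when `det A ≠ 0`: in logarithmic coordinates
  it is the linear map `A`, and `A v = 0 ⇒ v = 0` over `ℝ` (`Matrix.eq_zero_of_mulVec_eq_zero`).

The generator already packages `r'.domain = Φ_A '' r.domain` and the integrand identity, so
`[r] − [r'] ∈ KZ.changeOfVariablesRel ⊆ KZ.relations`. (lead c10 of crux 9129, banking)
-/

open Set MeasureTheory MvPolynomial
open Literature.NumberTheory.Transcendental
open Literature.ModelTheory.ExponentialFields (IsSemialgebraic)

namespace Summit.KontsevichZagierPeriods.ToricCore

variable {n : ℕ}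

/-! ### Laurent monomials are semialgebraic -/

/-- A Laurent monomial `x ↦ ∏ⱼ xⱼ ^ aⱼ` (`a ∈ ℤⁿ`) is a `ℚ`-semialgebraic function on every
`ℚ`-semialgebraic subset of the open positive orthant: there it is the quotient of the monomials
`x^{a⁺}` and `x^{a⁻}`, the latter non-vanishing. [cite: BochnakCosteRoy1998, §2.2] -/
theorem isSemialgebraicFunOn_laurentMonomial {s : Set (Fin n → ℝ)} (hs : IsSemialgebraic ℚ s)
    (hpos : ∀ x ∈ s, ∀ i, 0 < x i) (a : Fin n → ℤ) :
    IsSemialgebraicFunOn ℚ s (fun x => ∏ j, x j ^ a j) := by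
  have hq : ∀ x ∈ s, aeval x (∏ j, (X j : MvPolynomial (Fin n) ℚ) ^ (-a j).toNat) ≠ 0 := by
    intro x hx
    rw [map_prod]
    exact Finset.prod_ne_zero_iff.mpr fun j _ => by
      rw [map_pow, aeval_X]
      exact pow_ne_zero _ (hpos x hx j).ne'
  refine (isSemialgebraicFunOn_aeval_div_aeval hs (∏ j, (X j : MvPolynomial (Fin n) ℚ) ^ (a j).toNat)
    (∏ j, (X j : MvPolynomial (Fin n) ℚ) ^ (-a j).toNat) hq).congr fun x hx => ?_
  -- an integer power is a quotient of natural powers: `t ^ z = t ^ z⁺ / t ^ z⁻` for `t ≠ 0`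
  have hzpow : ∀ {t : ℝ}, t ≠ 0 → ∀ z : ℤ, t ^ z = t ^ z.toNat / t ^ (-z).toNat := by
    intro t ht z
    conv_lhs => rw [← Int.toNat_sub_toNat_neg z]
    rw [zpow_sub₀ ht, zpow_natCast, zpow_natCast]
  simp only [map_prod, map_pow, aeval_X]
  rw [← Finset.prod_div_distrib]
  exact Finset.prod_congr rfl fun j _ => (hzpow (hpos x hx j).ne' (a j)).symm

/-- The integer monomial map `Φ_A x = (∏ⱼ xⱼ ^ A i j)ᵢ` is a `ℚ`-semialgebraic map on every
`ℚ`-semialgebraic subset of the open positive orthant (coordinatewise Laurent monomials).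
[cite: BochnakCosteRoy1998, §2.2] -/
theorem isSemialgebraicMapOn_monomialMap {s : Set (Fin n → ℝ)} (hs : IsSemialgebraic ℚ s)
    (hpos : ∀ x ∈ s, ∀ i, 0 < x i) (A : Matrix (Fin n) (Fin n) ℤ) :
    IsSemialgebraicMapOn ℚ s (fun (x : Fin n → ℝ) (i : Fin n) => ∏ j, x j ^ A i j) :=
  IsSemialgebraicMapOn.of_forall hs fun i => isSemialgebraicFunOn_laurentMonomial hs hpos (A i)

/-! ### Derivative and Jacobian of the monomial map -/

/-- **Derivative of the monomial map.** At a point with non-zero coordinates,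
`Φ_A x = (∏ⱼ xⱼ ^ A i j)ᵢ` is differentiable with derivative the linear map of matrix
`(Φᵢ(x) · A i j · xⱼ⁻¹)ᵢⱼ` (Leibniz rule, `d/dt t^m = m t^{m-1}`). [folklore] -/
theorem hasFDerivAt_monomialMap (A : Matrix (Fin n) (Fin n) ℤ) {x : Fin n → ℝ}
    (hx : ∀ i, x i ≠ 0) :
    HasFDerivAt (fun (x : Fin n → ℝ) (i : Fin n) => ∏ j, x j ^ A i j)
      (ContinuousLinearMap.pi fun i => ∑ j, ((∏ k, x k ^ A i k) * ((A i j : ℝ) * (x j)⁻¹)) •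
        ContinuousLinearMap.proj (R := ℝ) (φ := fun _ : Fin n => ℝ) j) x := by
  classical
  rw [hasFDerivAt_pi]
  intro i
  have hz : ∀ j, HasFDerivAt (fun y : Fin n → ℝ => y j ^ A i j)
      (((A i j : ℝ) * x j ^ (A i j - 1)) •
        ContinuousLinearMap.proj (R := ℝ) (φ := fun _ : Fin n => ℝ) j) x := fun j => by
    have h := (hasDerivAt_zpow (A i j) (x j) (Or.inl (hx j))).comp_hasFDerivAt x
      (hasFDerivAt_apply (𝕜 := ℝ) j x)
    simpa only [Function.comp_def] using h
  have hprod := HasFDerivAt.finsetProd (u := Finset.univ) (fun j _ => hz j)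
  refine hprod.congr_fderiv (Finset.sum_congr rfl fun j _ => ?_)
  rw [smul_smul]
  congr 1
  rw [← Finset.prod_erase_mul Finset.univ (fun k => x k ^ A i k) (Finset.mem_univ j),
    zpow_sub_one₀ (hx j)]
  ring

/-- The determinant of the "pi of sums of scaled coordinate projections" continuous linear map
with coefficients `c i j` is `det c`. [folklore] -/
theorem det_pi_sum_smul_proj_eq_det_of (c : Fin n → Fin n → ℝ) :
    (ContinuousLinearMap.pi fun i => ∑ j, c i j •
        ContinuousLinearMap.proj (R := ℝ) (φ := fun _ : Fin n => ℝ) j).det = (Matrix.of c).det := by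
  classical
  set L : (Fin n → ℝ) →L[ℝ] (Fin n → ℝ) := ContinuousLinearMap.pi fun i => ∑ j, c i j •
    ContinuousLinearMap.proj (R := ℝ) (φ := fun _ : Fin n => ℝ) j with hL
  have hentry : ∀ i j, LinearMap.toMatrix' (L : (Fin n → ℝ) →ₗ[ℝ] (Fin n → ℝ)) i j = c i j := by
    intro i j
    rw [LinearMap.toMatrix'_apply]
    simp [hL, Pi.single_apply, Finset.sum_ite_eq']
  rw [ContinuousLinearMap.det, ← LinearMap.det_toMatrix']
  congr 1
  ext i j
  rw [hentry, Matrix.of_apply]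

/-- **Jacobian determinant of the monomial map**: `det (Φᵢ · A i j · eⱼ)ᵢⱼ =
(∏ᵢ Φᵢ) · det A · ∏ⱼ eⱼ`, since the matrix is `diag(Φ) · A · diag(e)`. [folklore] -/
theorem det_of_monomialJacobian (A : Matrix (Fin n) (Fin n) ℤ) (Φ e : Fin n → ℝ) :
    (Matrix.of fun i j => Φ i * ((A i j : ℝ) * e j)).det = (∏ i, Φ i) * (A.det : ℝ) * ∏ j, e j := by
  have h : (Matrix.of fun i j => Φ i * ((A i j : ℝ) * e j)) =
      Matrix.diagonal Φ * ((A.map fun z : ℤ => (z : ℝ)) * Matrix.diagonal e) := by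
    ext i j
    simp [Matrix.mul_diagonal, Matrix.map_apply]
  rw [h, Matrix.det_mul, Matrix.det_mul, Matrix.det_diagonal, Matrix.det_diagonal, ← Int.cast_det]
  ring

/-! ### Injectivity of the monomial map -/

/-- **Injectivity of the monomial map** on the open positive orthant when `det A ≠ 0`: taking
logarithms, `Φ_A x = Φ_A y` says `A · (log x − log y) = 0`, hence `log x = log y`
(`Matrix.eq_zero_of_mulVec_eq_zero` over `ℝ`), hence `x = y`. [folklore] -/
theorem injOn_monomialMap (A : Matrix (Fin n) (Fin n) ℤ) (hA : A.det ≠ 0) {s : Set (Fin n → ℝ)}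
    (hpos : ∀ x ∈ s, ∀ i, 0 < x i) :
    InjOn (fun (x : Fin n → ℝ) (i : Fin n) => ∏ j, x j ^ A i j) s := by
  intro x hx y hy hxy
  have hlog : ∀ i, ∑ j, (A i j : ℝ) * Real.log (x j) = ∑ j, (A i j : ℝ) * Real.log (y j) := by
    intro i
    have h := congr_arg Real.log (congr_fun hxy i)
    simp only at h
    rw [Real.log_prod (fun j _ => (zpow_pos (hpos x hx j) _).ne'),
      Real.log_prod (fun j _ => (zpow_pos (hpos y hy j) _).ne')] at h
    simpa only [Real.log_zpow] using h
  have hA' : (A.map fun z : ℤ => (z : ℝ)).det ≠ 0 := by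
    rw [← Int.cast_det]
    exact_mod_cast hA
  have hv : (A.map fun z : ℤ => (z : ℝ)).mulVec (fun j => Real.log (x j) - Real.log (y j)) = 0 := by
    ext i
    simp only [Matrix.mulVec, dotProduct, Matrix.map_apply, Pi.zero_apply, mul_sub,
      Finset.sum_sub_distrib, hlog i, sub_self]
  have h0 := Matrix.eq_zero_of_mulVec_eq_zero hA' hv
  funext j
  have hj := congr_fun h0 j
  simp only [Pi.zero_apply, sub_eq_zero] at hj
  exact Real.log_injOn_pos (hpos x hx j) (hpos y hy j) hj

/-! ### Monomial moves are change-of-variables moves -/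

/-- **A monomial move is an instance of KZ's rule (2).** For `A ∈ Mₙ(ℤ)` with `det A ≠ 0`, `r`
supported in the open positive orthant, `r'.domain = Φ_A '' r.domain` and
`r.integrand = (r'.integrand ∘ Φ_A) · |det A| (∏ᵢ ∏ⱼ xⱼ ^ A i j) / ∏ⱼ xⱼ` on `r.domain`,
`[r] − [r'] ∈ KZ.changeOfVariablesRel`: `Φ_A` is semialgebraic, differentiable and injective there
and `|det DΦ_A(x)| = |det A| (∏ᵢ ∏ⱼ xⱼ ^ A i j) / ∏ⱼ xⱼ`.
[cite: KontsevichZagier2001, §1.2 rule (2)] -/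
theorem monomial_sub_mem_changeOfVariablesRel (r r' : KZ.IntegralRep n)
    (A : Matrix (Fin n) (Fin n) ℤ) (hA : A.det ≠ 0) (hpos : ∀ x ∈ r.domain, ∀ i, 0 < x i)
    (hdom : r'.domain = (fun x i => ∏ j, x j ^ A i j) '' r.domain)
    (hint : ∀ x ∈ r.domain, r.integrand x =
      r'.integrand (fun i => ∏ j, x j ^ A i j) *
        (|(A.det : ℝ)| * (∏ i, ∏ j, x j ^ A i j) / ∏ j, x j)) :
    KZ.of r - KZ.of r' ∈ KZ.changeOfVariablesRel := by
  refine ⟨n, r, r', fun x i => ∏ j, x j ^ A i j, fun x => ContinuousLinearMap.pi fun i =>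
      ∑ j, ((∏ k, x k ^ A i k) * ((A i j : ℝ) * (x j)⁻¹)) •
        ContinuousLinearMap.proj (R := ℝ) (φ := fun _ : Fin n => ℝ) j,
    isSemialgebraicMapOn_monomialMap r.isSemialgebraic_domain hpos A,
    fun x hx => (hasFDerivAt_monomialMap A fun i => (hpos x hx i).ne').hasFDerivWithinAt,
    injOn_monomialMap A hA hpos, hdom, fun x hx => ?_, rfl⟩
  rw [hint x hx, det_pi_sum_smul_proj_eq_det_of, det_of_monomialJacobian]
  congr 1
  have hP : 0 < ∏ i, ∏ j, x j ^ A i j :=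
    Finset.prod_pos fun i _ => Finset.prod_pos fun j _ => zpow_pos (hpos x hx j) _
  have hX : 0 < ∏ j, x j := Finset.prod_pos fun j _ => hpos x hx j
  rw [abs_mul, abs_mul, abs_of_pos hP, Finset.prod_inv_distrib, abs_inv, abs_of_pos hX]
  ring

/-- **`R_tor ≤ KZ.relations`** for the Literature constants: the toric relations are KZ relations.
Generators of the first kind are KZ moves (1a), (1b), (3) by definition; generators of the second
kind (monomial moves) are instances of rule (2) by `monomial_sub_mem_changeOfVariablesRel`.
[cite: KontsevichZagier2001, §1.2] -/
theorem toricRelations_le_relations : KZ.toricRelations ≤ KZ.relations := by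
  refine KZ.toricRelations_le (fun c hc => ?_) (fun c hc => ?_)
  · rcases hc.1 with (h | h) | h
    · exact KZ.domainAddRel_subset_relations h
    · exact KZ.integrandAddRel_subset_relations h
    · exact KZ.newtonLeibnizRel_subset_relations h
  · obtain ⟨n, r, r', A, -, -, hA, hpos, hdom, hint, rfl⟩ := hc
    exact KZ.changeOfVariablesRel_subset_relations
      (monomial_sub_mem_changeOfVariablesRel r r' A hA hpos hdom hint)

/-- **`ToricSound`** (route ToricCore, stmt-KontsevichZagierPeriods-7842): the toric sub-calculus
`R_tor` — generated by the support-toric instances of the KZ moves (1a), (1b), (3) and by the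
integer monomial changes of variables `x ↦ (∏ⱼ xⱼ ^ A i j)ᵢ`, `det A ≠ 0`, on domains in the open
positive orthant — is contained in `KZ.relations`. The route's inline `let T; let R` are token for
token `KZ.toricSpan`, `KZ.toricRelations`, so this is `toricRelations_le_relations` (moves of the
first kind are relations by definition; a monomial move is a rule-(2) instance: semialgebraic,
differentiable with `|det DΦ_A| = |det A| ∏ᵢ∏ⱼ xⱼ^{A i j} / ∏ⱼ xⱼ`, injective via logarithms).
[cite: KontsevichZagier2001, §1.2 rule (2)] -/
theorem toricSound_proof :
    Summit.KontsevichZagierPeriods.KontsevichZagierPeriods.Theses.ToricCore.ToricSound :=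
  toricRelations_le_relations

end Summit.KontsevichZagierPeriods.ToricCore
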